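import Mathlib.Geometry.Manifold.PoincareConjecture
import Literature.Topology.FourManifolds.Trisections
import Literature.Topology.FourManifolds.ClosedBall
import HarnessLib

/-!
# Genus-three trisections with a dependent triple are standard (Aranda–Zupan 2025, Thm. 1.4) —
homotopy-sphere corollary

Named fact (D-0014), companion of `WeaklyReducibleGenusThreeTrisections.lean` (the homotopy-sphere
corollary of Thm. 1.3 of the same paper, `arandaZupan_weaklyReducible_genusThree_homotopySphere`).
Requested by route SmoothPoincare4/WeakReductionDescent: it is VERBATIM the support item
`DependentTripleGenusThreeStandard` (stmt-SmoothPoincare4-18000) and it is the printed converse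
context of the crux `DependentTripleAtThree` (stmt-SmoothPoincare4-17999: "every minimal-genus
genus-3 GK-trisection of a smooth homotopy 4-sphere admits a dependent triple" — NOT printed, open;
together with this fact and the genus-`≤ 2` rungs it is equivalent to "no smooth homotopy 4-sphere has
trisection genus 3", the homotopy-sphere case of Meier's Conjecture 1.1 of arXiv:1708.01214 =
Conjecture 1.2 of the source).

Source read (held arXiv text, `paper:arxiv-2503.04607`, pp. 2, 24–26): R. Aranda, A. Zupan,
*Manifolds with weakly reducible genus-three trisections are standard* (2025).

* **Dependent triple** (p. 2, verbatim): "Given a trisection `𝒯` for `X` with spine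
  `H_α ∪ H_β ∪ H_γ`, a dependent triple for `𝒯` consists of three pairwise disjoint non-separating
  curves `α₁`, `β₁`, and `γ₁` bounding disks in `H_α`, `H_β`, and `H_γ`, respectively, such that the
  homology classes `[α₁]`, `[β₁]`, and `[γ₁]` are linearly dependent in `H₁(Σ)`."  (Repeated in §7,
  p. 24.)  Conventions (§2, p. 3): manifolds smooth and orientable; a curve in `Σ` is an essential
  simple closed curve; a compressing disk of a handlebody `H` is a properly embedded disk `D ⊂ H`
  with `∂D` a curve in `Σ = ∂H`.
* **Theorem 1.4** (p. 2, verbatim): "Suppose a genus-three trisection `𝒯` of `X` admits a dependent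
  triple. Then either `𝒯` is reducible, or `𝒯` contains a five-chain. In particular, `X` is
  diffeomorphic to a spun lens space `S_p` or its sibling `S'_p`, `S⁴`, or a connected sum of copies
  of `±ℂP²`, `S¹ × S³`, and `S² × S²`."  Proof: §7, pp. 25–26 (three cases of Figure 18; cases (1),
  (2) reduce to weak reducibility and Thm. 1.3, case (3) — a pants-cobounding triple — is handled by
  Lemmas 3.7/3.8 and five-chain surgery).
* **Corollary 1.5** (p. 2, verbatim): "If `X` is simply-connected and admits a genus-three
  trisection `𝒯` with a dependent triple, then `X` is diffeomorphic to `S⁴` or a connected sum of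
  copies of `±ℂP²`, and `S² × S²`."

The route needs this only for HOMOTOPY 4-SPHERES: `π₁ = 1` puts us in Corollary 1.5 and `H₂ = 0`
excludes every non-empty connected sum of `±ℂP²`, `S² × S²` (each summand contributes a free
summand to `H₂`), leaving `S⁴`.  We therefore record the corollary with conclusion "diffeomorphic to
`S⁴`" (weaker than, and implied by, the printed classification), with the hypotheses spelled out
EXACTLY as in the route items (so that `DependentTripleGenusThreeStandard` closes by `exact h`):

* the 4-manifold: bare binders `(M : Type)` with `T2Space`, `SecondCountableTopology`,
  `ChartedSpace (EuclideanSpace ℝ (Fin 4))`, `IsManifold (𝓡 4) ∞` and a homotopy equivalence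
  `M ≃ₕ S⁴` (forcing `M` closed, connected, simply connected, `H₂ = 0`, orientable);
* the trisection: `IsGKTrisection M 3 k T` for some `k : Fin 3 → ℕ` (central surface `F = ⋂ T l`,
  handlebodies `H p = ⋂_{l ≠ p} T l`);
* the dependent triple: pairwise disjoint curves `a, b, c ⊆ F` (images of smooth embeddings of
  `S¹`), each non-separating in `F` (`F ∖ a` connected, …), `a` bounding a smoothly, properly embedded
  closed `2`-disc in `H 0` (image in `H 0`, boundary circle sent onto `a`, meeting `F` exactly in `a`),
  `b` in `H 1`, `c` in `H 2` — AZ's compressing discs, one per handlebody as printed ("respectively");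
  and LINEAR DEPENDENCE of `[a], [b], [c]` in `H₁(F)` rendered as "`F ∖ (a ∪ b ∪ c)` is disconnected"
  (`¬ IsPreconnected`).  This rendering is the tree's transcription of the printed homological
  condition and is EQUIVALENT to it for pairwise disjoint simple closed curves on a closed connected
  orientable surface: in the exact sequence `H₂(F) → H₂(F, C) → H₁(C) → H₁(F)` of the pair
  `(F, C = a ⊔ b ⊔ c)`, `H₂(F, C) ≅ H⁰(F ∖ C) = ℤ^m` (`m` = number of complementary components,
  Lefschetz duality on the cut surface) and the image of `H₂(F) = ℤ` is the diagonal, so the kernel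
  of `ℤ³ = H₁(C) → H₁(F)` has rank `m − 1`: the three classes are linearly dependent (over `ℤ`, `ℚ`
  or `ℤ/2` alike) iff `m ≥ 2`.  (AZ §7 p. 24 list the three configurations; in each the complement
  is disconnected.)

## Proof status (provefact seat, 2026-08-17): not discharged — XL; waiting on the Thm 1.3 fact

Statement re-read against the materialised pages of arXiv:2503.04607v1 (pp. 2, 3, 5, 6, 24–26) and
confirmed as printed (p. 5: AZ trisections are `(g; k₁, k₂, k₃)`-trisections, so any `k` is
allowed; p. 2 / p. 24: one compressing curve per handlebody, pairwise disjoint, non-separating,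
dependent — rendered as above); a complete proof is printed (§7 on §§3–6), so the fact is neither
mis-stated nor an open problem.  Why there is no `_holds`, as dependencies on EXISTING tree facts:

* *Printed proof* (§7, pp. 25–26).  Up to homeomorphism a dependent triple on the genus-`3`
  surface is one of three configurations (p. 24, Fig. 18): (1) two curves homotopic — then `𝒯` is
  weakly reducible, apply Thm. 1.3; (2) two curves homologous, not homotopic — Lemma 3.8 (p. 10:
  untelescoping / thin position [CG87, ST94], Lemmas 3.4, 3.6) applied to the genus-`3` splitting
  `H_β ∪ H_γ` of `∂Xᵢ ∈ {S³, S¹ × S²}` (`kᵢ ≤ 1` by [MSZ16], p. 6 Prop. 2.6) makes `𝒯` weakly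
  reducible, apply Thm. 1.3; (3) the triple cobounds a pair of pants — either some curve compresses
  in a second handlebody (Thm. 1.3 again) or Lemma 3.7 (p. 9) twice plus handle slides produce a
  five-chain `{γ₁, β₂, α₁, γ₂*, β₁}` (Fig. 19), and five-chain surgery (Lemma 5.4, Prop. 5.5) with
  the genus-two classification [MZ17b] gives the list (Lemma 7.1, from [CT19], only removes
  `S_p # ±ℂP²`).  So Thm. 1.3 is invoked in EVERY case: the first prerequisite is the tree's
  UNPROVED fact `Literature.Topology.FourManifolds.arandaZupan_weaklyReducible_genusThree_homotopySphere`
  (`WeaklyReducibleGenusThreeTrisections.lean`, same binder shape as this fact; by the proved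
  `Literature.Barriers.SmoothPoincare4.az2025_weaklyReducible_genusThree_homotopySphere_gk_iff_routeShape`
  / `…_iff_topic` it is the barrier-catalogue fact `az2025_weaklyReducible_genusThree_homotopySphere_gk`
  and the topic fact `arandaZupan_genus_three_weaklyReducible_homotopySphere_gk`), itself triaged
  XL and left waiting on `Literature.Topology.FourManifolds.waldhausen_heegaardSplitting_sumS1S2_unique`.
  The proximate prerequisite is the barrier-catalogue vendoring
  `Literature.Barriers.SmoothPoincare4.az2025_weaklyReducible_genusThree_homotopySphere_gk` — the
  TRACKED form of Thm. 1.3 (it carries the proof-status record and the provefact seats of Thm. 1.3;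
  the route-shaped statement above is an alias of it at every universe,
  `az2025_weaklyReducible_genusThree_homotopySphere_gk_iff_routeShape_univ`, so either discharge
  gives the other in one line); on the ledger that fact is `needs-decomposition` (XL) and waits on
  Waldhausen's theorem, so this unit is parked (`blocked-on`) on the live leaf of the chain,
  `Literature.Topology.FourManifolds.waldhausen_heegaardSplitting_sumS1S2_unique` (claims T→B→W
  registered and released, 2026-08-17): when it lands, re-check the Thm. 1.3 fact first.
* *Lower bound.*  Conversely this fact contains the Thm. 1.3 fact — a weak reduction `(c; c′)`
  yields the dependent triple `(c, c′, parallel push-off of c′)` (p. 2: Thm. 1.4 is "a stronger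
  version of Theorem 1.3"; formally this needs a collar of the compressing disc in the handlebody,
  not in the tree) — and therefore, like it, Cerf's `Γ₄ = 0`
  (`Literature.Topology.FourManifolds.cerf_twistedSphere_four`, unproved): a twisted sphere carries
  the bevelled genus-`0` trisection whose three-fold stabilisation is a weakly reducible
  `(3; 1,1,1)`-trisection (`Barriers/SmoothPoincare4/LowGenusTrisectionsStandardProofs.lean`,
  "Why `msz_homotopySphere_gk` is not discharged").
* *Inputs with no declaration in the tree:* Lemmas 3.7, 3.8 and their 3-manifold inputs
  (generalized Heegaard splittings, Prop. 2.4 [CG87, ST94, SSS16], Lemmas 3.4–3.6), handle slides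
  (Remark 2.1), five-chains and five-chain surgery (§5), surgery on loops and siblings [Glu62,
  Pao77, LP72] (§2, p. 7), the general genus-two theorem [MZ17b] (the tree has only the
  homotopy-sphere slice `Literature.Barriers.SmoothPoincare4.mz_genus_le_two_homotopySphere_gk`,
  unproved), and the correspondence trisection diagrams ↔ `IsGKTrisection` (Gay–Kirby +
  Laudenbach–Poénaru, `Literature.Topology.FourManifolds.exists_diffeomorph_comp_incl_eq`, unproved).
* *Proved in tree* (Summits side,
  `Summits/SmoothPoincare4/SmoothPoincare4/Theorems/WeakReductionDescentDependentTripleGenusThreeStandard.lean`):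
  the route item is this fact (`dependentTripleGenusThreeStandard_iff_arandaZupan`, `Iff.rfl`), it
  is implied by `SmoothPoincare4` (`dependentTripleGenusThreeStandard_of_smoothPoincare`), and GIVEN
  `Literature.Barriers.SmoothPoincare4.msz_homotopySphere_gk` it reduces to balanced
  `(3; 1,1,1)`-trisections (`dependentTripleGenusThreeStandard_of_msz_of_balanced`, via the proved
  Euler identity `gkTrisection_genus_eq_sum_of_homotopyEquiv_sphere_holds`) — exactly AZ's
  standing assumption `kᵢ ∈ {0, 1}` (p. 6).
* *Proved in tree* (Literature side, the sibling `DependentTripleGenusThreeTrisectionsProofs.lean`,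
  NO new fact): the dependent triple as a predicate `Trisection.HasDependentTriple` in the
  vocabulary of `WeaklyReducibleTrisections.lean` (by `rfl` the `let`-block below; indexed form,
  invariance under relabelling the sectors, naturality under diffeomorphisms), the sentence of
  §7 p. 25 "If any of the curves bounds a disk in another handlebody, then the splitting is
  weakly reducible" (`Trisection.isWeaklyReducible_of_triple_of_boundsDisc_other`), the shield
  `…_of_smoothPoincare`, and the reductions of this fact: GIVEN `msz_homotopySphere_gk` it is
  equivalent to its `(3; 1,1,1)` instance (`…_of_msz_of_balanced`, `….balanced`); GIVEN the
  Thm. 1.3 fact it reduces to trisections that are NOT weakly reducible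
  (`…_of_weaklyReducible_of_notWeaklyReducible` — cases (1), (2) and the first sub-case of (3) of
  the printed proof); GIVEN moreover the two splitting facts of `ReducibleTrisectionSplitting.lean`
  the reducible branch is proved, so that, the four named facts granted, the outstanding content
  is exactly the hypothesis `h5` of `…_of_facts_of_fiveChainCase`: a smooth `M ≃ₕ S⁴` with a
  `(3; 1,1,1)`-trisection admitting a dependent triple, neither weakly reducible nor reducible, is
  `S⁴` — the five-chain construction of case (3) (pp. 25–26), absent from the tree.  Section
  "Catalogue" of the sibling restates these reductions from the tracked forms of the four named
  facts at ANY universes (`…_of_az2025_facts_of_fiveChainCase`, from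
  `Literature.Barriers.SmoothPoincare4.az2025_weaklyReducible_genusThree_homotopySphere_gk.{u}`,
  `msz_homotopySphere_gk.{v}` and the splitting facts at arbitrary universes), records the
  decomposition that does NOT pass through Thm. 1.3 (`…_of_msz_of_splitting_of_irreducible_univ`:
  inputs Meier–Schirmer–Zupan's fact and the two splitting facts only, residue = this theorem for
  IRREDUCIBLE `(3; 1,1,1)`-trisections, i.e. "`𝒯` contains a five-chain", §§3–5 + [MZ17b]), and
  proves that, the four facts granted, this fact is EQUIVALENT to `h5`
  (`arandaZupan_dependentTriple_genusThree_homotopySphere_iff_fiveChainCase_of_facts`).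

## Split review (review-split seat, 2026-08-17): confirmed as printed; nothing to restate or merge; no inline road

Reviewed as a D-0026/D-0027 "decomposition child" with the source open (arXiv:2503.04607v1,
pp. 2, 3, 24–26).  (a) *Not a cut.*  The def was vendored whole, as the Literature grounding of
the route item `DependentTripleGenusThreeStandard` (which it is, `Iff.rfl`); it has no split
parent, so there is nothing to merge it back into, and it is not a slice of the Thm. 1.3 fact but
CONTAINS it (p. 2: Thm. 1.4 is "a stronger version of Theorem 1.3").  (b) *Nothing to restate.*
Hypotheses and conclusion are as printed (section "Proof status" above); re-checked here: p. 3
"By a curve in a surface `Σ`, we mean a free homotopy class of an essential simple closed curve",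
so the printed "pairwise disjoint curves" are classes realised disjointly and case (1) of p. 24
("two of the curves are homotopic") is two parallel copies — the def's three pairwise disjoint
embedded circles are such representatives, and non-separating circles are essential; the
separation clause implies the printed linear dependence with no appeal to duality — if
`F ∖ (a ∪ b ∪ c)` is not preconnected it splits into non-empty relatively clopen `R ⊔ R'`, the
frontier of `R̄` is a union of whole curves among `a, b, c` (each curve has a product
neighbourhood whose two sides lie in `F ∖ (a ∪ b ∪ c)`), at least one of them has `R` on one side
only because `F` is connected, and then `∂[R̄] = Σ ± [curve] = 0` in `H₁(F)` is a non-trivial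
relation with coefficients `±1`; compactness of `M` ("closed", p. 5) is part of `IsGKTrisection`
(`IsGKTrisection.compactSpace`) and is anyway forced by `H₄(M; ℤ/2) ≅ H₄(S⁴; ℤ/2) ≠ 0`;
orientability by `π₁(M) = 1`.  (c) *Not an open problem:* the complete proof is printed (§7,
pp. 25–26).  (d) *No inline road:* each case of the printed proof ends in "apply Theorem 1.3"
(p. 25: case (1) directly, case (2) via Lemma 3.8, and the first sub-case of (3)), i.e. in the
tree's UNPROVED fact
`Literature.Barriers.SmoothPoincare4.az2025_weaklyReducible_genusThree_homotopySphere_gk` (itself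
XL: Prop. 3.9, §§4–6, Waldhausen's theorem), and the remaining sub-case of (3) needs Lemma 3.7,
handle slides, five-chains and five-chain surgery (§5, Lemma 5.4, Prop. 5.5) and [MZ17b], none of
which is declared in the tree; the kernel-checked residue is the hypothesis `h5` of the sibling's
`arandaZupan_dependentTriple_genusThree_homotopySphere_of_az2025_facts_of_fiveChainCase`.  The
fact therefore stays a named fact parked (`blocked-on`) on the Thm. 1.3 fact; the Summits-side
item it grounds was promoted support → crux (2026-08-17) to be split along the printed proof
there, not in `Literature/`.

## References

* [ArandaZupan2025] R. Aranda, A. Zupan, *Manifolds with weakly reducible genus-three trisections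
  are standard*, arXiv:2503.04607 (2025), Thm. 1.4 and Cor. 1.5 (p. 2), §7 (pp. 24–26).
* [GayKirby2016] D. Gay, R. Kirby, *Trisecting 4-manifolds*, Geom. Topol. 20 (2016), Def. 1.
* [MeierSchirmerZupan2016] J. Meier, T. Schirmer, A. Zupan, *Classification of trisections and the
  Generalized Property R Conjecture*, PAMS 144 (2016) (the `(g; k)` trisections with `k ≥ g − 1`).
-/

noncomputable section

open scoped Manifold ContDiff
open Set ContinuousMap

namespace Literature.Topology.FourManifolds

/-- **Aranda–Zupan 2025, Thm. 1.4 / Cor. 1.5 — homotopy-sphere corollary over `IsGKTrisection`.**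
Let `M` be a smooth 4-manifold (Hausdorff, second countable, modelled on `ℝ⁴`, `C^∞`) homotopy
equivalent to `S⁴`, with a Gay–Kirby `(3; k₀, k₁, k₂)`-trisection `T` (`IsGKTrisection M 3 k T`;
central surface `F = ⋂ T l`, handlebodies `H p = ⋂_{l ≠ p} T l`) admitting a **dependent triple**:
pairwise disjoint smoothly embedded circles `a, b, c ⊆ F`, each non-separating in `F`, with `a`
bounding a smoothly, properly embedded closed disc in `H 0`, `b` in `H 1`, `c` in `H 2` (each disc
meeting `F` exactly along its boundary curve), whose union SEPARATES `F` (equivalently, for pairwise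
disjoint curves, `[a], [b], [c]` are linearly dependent in `H₁(F)` — see the module docstring).  Then
`M` is diffeomorphic to `S⁴`.  Printed (p. 2): Thm. 1.4 "Suppose a genus-three trisection `𝒯` of `X`
admits a dependent triple. Then either `𝒯` is reducible, or `𝒯` contains a five-chain. In
particular, `X` is diffeomorphic to a spun lens space `S_p` or its sibling `S'_p`, `S⁴`, or a
connected sum of copies of `±ℂP²`, `S¹ × S³`, and `S² × S²`"; Cor. 1.5 "If `X` is simply-connected
and admits a genus-three trisection `𝒯` with a dependent triple, then `X` is diffeomorphic to `S⁴` or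
a connected sum of copies of `±ℂP²`, and `S² × S²`" — and a homotopy 4-sphere in this list is `S⁴`
(`H₂ = 0`).  Statement = the route item `DependentTripleGenusThreeStandard` of
`Summits/SmoothPoincare4/SmoothPoincare4/Theses/WeakReductionDescent.lean`, verbatim; grounds
`Summit.SmoothPoincare4.SmoothPoincare4.Theses.WeakReductionDescent.DependentTripleGenusThreeStandard`
and is the printed converse context of `…WeakReductionDescent.DependentTripleAtThree`.  Named fact
(D-0014). [cite: ArandaZupan2025, Thm. 1.4 and Cor. 1.5 (p. 2); dependent triple p. 2 and §7 p. 24; proof §7 pp. 25–26] -/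
def arandaZupan_dependentTriple_genusThree_homotopySphere : Prop :=
  ∀ (M : Type) [TopologicalSpace M] [T2Space M] [SecondCountableTopology M]
    [ChartedSpace (EuclideanSpace ℝ (Fin 4)) M] [IsManifold (𝓡 4) ((⊤ : ℕ∞) : WithTop ℕ∞) M],
    (M ≃ₕ (Metric.sphere (0 : EuclideanSpace ℝ (Fin 5)) 1)) →
    ∀ (k : Fin 3 → ℕ) (T : Fin 3 → Set M),
      Literature.Topology.FourManifolds.IsGKTrisection M 3 k T →
      (let F : Set M := ⋂ l, T l
       let H : Fin 3 → Set M := fun p => ⋂ (l : Fin 3) (_ : l ≠ p), T l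
       let IsCurve : Set M → Prop := fun c => c ⊆ F ∧
         ∃ γ : (Metric.sphere (0 : EuclideanSpace ℝ (Fin 2)) 1) → M,
           Manifold.IsSmoothEmbedding (𝓡 1) (𝓡 4) ((⊤ : ℕ∞) : WithTop ℕ∞) γ ∧ Set.range γ = c
       let BoundsDisc : Set M → Set M → Prop := fun A c =>
         ∃ d : (Metric.closedBall (0 : EuclideanSpace ℝ (Fin 2)) 1) → M,
           Manifold.IsSmoothEmbedding (𝓡∂ 2) (𝓡 4) ((⊤ : ℕ∞) : WithTop ℕ∞) d ∧
             Set.range d ⊆ A ∧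
             d '' ((𝓡∂ 2).boundary (Metric.closedBall (0 : EuclideanSpace ℝ (Fin 2)) 1)) = c ∧
             Set.range d ∩ F = c
       let NonSep : Set M → Prop := fun c => IsConnected (F \ c)
       let DependentTriple : Prop := ∃ (a b c : Set M), IsCurve a ∧ IsCurve b ∧ IsCurve c ∧
         Disjoint a b ∧ Disjoint b c ∧ Disjoint a c ∧ NonSep a ∧ NonSep b ∧ NonSep c ∧
         BoundsDisc (H 0) a ∧ BoundsDisc (H 1) b ∧ BoundsDisc (H 2) c ∧
         ¬ IsPreconnected (F \ (a ∪ b ∪ c))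
       DependentTriple) →
      Nonempty (Diffeomorph (𝓡 4) (𝓡 4) M (Metric.sphere (0 : EuclideanSpace ℝ (Fin 5)) 1)
        ((⊤ : ℕ∞) : WithTop ℕ∞))

/-- Sanity: the fact is literally the route item's statement shape — instantiating it closes a goal of
that shape by `exact`. [folklore] -/
example (h : arandaZupan_dependentTriple_genusThree_homotopySphere)
    (M : Type) [TopologicalSpace M] [T2Space M] [SecondCountableTopology M]
    [ChartedSpace (EuclideanSpace ℝ (Fin 4)) M] [IsManifold (𝓡 4) ((⊤ : ℕ∞) : WithTop ℕ∞) M]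
    (e : M ≃ₕ (Metric.sphere (0 : EuclideanSpace ℝ (Fin 5)) 1)) (k : Fin 3 → ℕ) (T : Fin 3 → Set M)
    (hT : Literature.Topology.FourManifolds.IsGKTrisection M 3 k T) :=
  h M e k T hT

end Literature.Topology.FourManifolds

end
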